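import Summits.PneNP.PneNP.Theorems.ConvexRankGatesCliqueExtLowerBoundHorns
import Summits.PneNP.PneNP.Theorems.ConvexRankGatesCliqueExtLowerBoundStubNarrowAlgebraic

/-!
# Gates accepting every diameter-two graph are sandwichable on the referee pair
(sub-class of the leaf `stub_permCnf`, line `width-threshold-certificate-sparsity`, crux `CliqueExtLowerBound`,
stmt-PneNP-10682; stub-worker of lead c10 — extract of `work/stubs/StubPermCnf.lean`, which has the horn analysis)

On the referee pair (bare `⌈m^{1/4}⌉₊`-cliques vs complements `E ∖ M` of the `(#E/⌊m^{1/8}⌋₊)`-subsets `M` of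
the edge slots) every Boolean function of the edge slots that ACCEPTS EVERY GRAPH OF DIAMETER TWO is blind on
the negatives at the sharp threshold: all but `≤ m² 2^m / ⌊m^{1/8}⌋₊^{m-2} · #N ≤ #N / (8 m^{c+1})` negatives have
diameter two (a pair `u, v` without common neighbour forces the `m - 2` edges `{zu : z ∈ A} ∪ {zv : z ∉ A}`
into `M`, `A :=` the non-neighbours of `u`; a fixed set of `j` slots lies in `M` for a `≤ ⌊m^{1/8}⌋₊^{-j}`
fraction of the `M`, `card_filter_neg_mul_pow_le`; `≤ m² 2^m` such clauses), so the constant pair `({∅}, ∅)`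
has both errors `≤ 1/(8 m^{c+1})` (`Horns.pair_of_blind`): `pair_of_acceptsDiamTwo`. Members of the sub-class
among the PERM gates reading local CNFs of the edges: the VERTEX-TRANSPOSITION gates (points = the `m`
vertices, the wire of edge `ab` carries `(a b)`, ANY target `τ`; nonabelian; wide for `τ = (a b)`, whose
Hamiltonian `a–b` paths are minterms of `m - 1` wires; in the window `(a) ≈ m^{-3/2} > ε` for `c ≥ 1`) —
`closure_swaps_eq_top` (`(a b) = (w b)(a w)(w b)` for a common neighbour `w`, `Equiv.Perm.closure_isSwap`),
`transpositionGate_accepts_of_diamTwo`, `transpositionGate_isPermGate`, `transpositionGate_permCnf` (the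
leaf's conclusion for them); on paper also graphic `𝔽₂` span programs / `T`-join / connectivity gates.
-/

set_option linter.dupNamespace false
open Literature.Computability.Complexity Filter Finset
open Summit.PneNP.PneNP.Theorems.CliqueExtLowerBound.WidthThreshold

noncomputable section
namespace Summit.PneNP.PneNP.Theorems.CliqueExtLowerBound.WidthThreshold.DiamTwo

open Summit.PneNP.PneNP.Theorems.CliqueExtLowerBound.WidthThreshold.NarrowAlgebraicHelpers
  (card_filter_neg_mul_pow_le exists_mul_pow_le_two_pow cast_le_eps_mul lt_floor_rpow_add_one_pow)
open Summit.PneNP.PneNP.Theorems.CliqueExtLowerBound.WidthThreshold.NarrowAlgebraic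
  (card_mul_le_of_subset_biUnion)

/-! ## §1 Transposition gates accept every graph of diameter two -/

/-- **The edge transpositions of a diameter-two graph generate the symmetric group.** If in the
graph `y` on `Fin m` (an edge-slot vector) every two distinct vertices `u, v` have a common
neighbour `w`, then the transpositions `(a b)` of the on-edges `ab` generate `Sym(Fin m)`:
`(a b) = (w b)(a w)(w b)`, and all transpositions generate (`Equiv.Perm.closure_isSwap`).
[folklore] -/
theorem closure_swaps_eq_top {m : ℕ} (y : EV m → Bool)
    (hy : ∀ u v : Fin m, u ≠ v → ∃ w : Fin m,
      (∃ e : EV m, (e : Sym2 (Fin m)) = s(w, u) ∧ y e = true) ∧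
      (∃ e : EV m, (e : Sym2 (Fin m)) = s(w, v) ∧ y e = true)) :
    Subgroup.closure {σ : Equiv.Perm (Fin m) | ∃ e : EV m, y e = true ∧
      ∃ u v : Fin m, (e : Sym2 (Fin m)) = s(u, v) ∧ σ = Equiv.swap u v} = ⊤ := by
  set H := Subgroup.closure {σ : Equiv.Perm (Fin m) | ∃ e : EV m, y e = true ∧
      ∃ u v : Fin m, (e : Sym2 (Fin m)) = s(u, v) ∧ σ = Equiv.swap u v} with hH
  have hgen : ∀ (e : EV m) (a b : Fin m), (e : Sym2 (Fin m)) = s(a, b) → y e = true →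
      Equiv.swap a b ∈ H := fun e a b he hye =>
    Subgroup.subset_closure ⟨e, hye, a, b, he, rfl⟩
  have hswap : ∀ a b : Fin m, a ≠ b → Equiv.swap a b ∈ H := by
    intro a b hab
    obtain ⟨w, ⟨e₁, he₁, hy₁⟩, ⟨e₂, he₂, hy₂⟩⟩ := hy a b hab
    have hwa : w ≠ a := by
      have h := e₁.2
      rw [he₁, SimpleGraph.mem_edgeSet, SimpleGraph.top_adj] at h
      exact h
    have h1 : Equiv.swap a w ∈ H := by
      rw [Equiv.swap_comm]
      exact hgen e₁ w a he₁ hy₁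
    have h2 : Equiv.swap w b ∈ H := hgen e₂ w b he₂ hy₂
    have key : Equiv.swap w b * Equiv.swap a w * Equiv.swap w b = Equiv.swap b a :=
      Equiv.swap_mul_swap_mul_swap hwa.symm hab
    rw [Equiv.swap_comm, ← key]
    exact H.mul_mem (H.mul_mem h2 h1) h2
  refine top_unique ?_
  rw [← Equiv.Perm.closure_isSwap, Subgroup.closure_le]
  rintro σ ⟨a, b, hab, rfl⟩
  exact hswap a b hab

/-- **Transposition gates accept every diameter-two graph.** The VERTEX-TRANSPOSITION gate — points
the `m` vertices, the input wired to the edge slot `ab` carrying the transposition `(a b)`, any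
target `τ` — accepts every edge vector in which every two distinct vertices have a common
neighbour (all wirings `w` onto the edge slots, repetitions allowed). [folklore] -/
theorem transpositionGate_accepts_of_diamTwo {m k : ℕ} (w : Fin k → EV m)
    (hw : Function.Surjective w) (τ : Equiv.Perm (Fin m)) (x : EV m → Bool)
    (hx : ∀ u v : Fin m, u ≠ v → ∃ z : Fin m,
      (∃ e : EV m, (e : Sym2 (Fin m)) = s(z, u) ∧ x e = true) ∧
      (∃ e : EV m, (e : Sym2 (Fin m)) = s(z, v) ∧ x e = true)) :
    τ ∈ Subgroup.closure ((fun i => Sym2.lift ⟨fun a b => Equiv.swap a b,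
      fun a b => Equiv.swap_comm a b⟩ ((w i : EV m) : Sym2 (Fin m))) '' {i | x (w i) = true}) := by
  have htop := closure_swaps_eq_top x hx
  have hle : Subgroup.closure {σ : Equiv.Perm (Fin m) | ∃ e : EV m, x e = true ∧
      ∃ u v : Fin m, (e : Sym2 (Fin m)) = s(u, v) ∧ σ = Equiv.swap u v} ≤
      Subgroup.closure ((fun i => Sym2.lift ⟨fun a b => Equiv.swap a b,
        fun a b => Equiv.swap_comm a b⟩ ((w i : EV m) : Sym2 (Fin m))) '' {i | x (w i) = true}) := by
    refine Subgroup.closure_mono ?_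
    rintro σ ⟨e, hxe, u, v, he, rfl⟩
    obtain ⟨i, rfl⟩ := hw e
    refine ⟨i, hxe, ?_⟩
    show Sym2.lift _ ((w i : EV m) : Sym2 (Fin m)) = Equiv.swap u v
    rw [he, Sym2.lift_mk]
  rw [htop, top_le_iff] at hle
  exact hle ▸ Subgroup.mem_top τ

open Classical in
/-- The vertex-transposition gate IS a PERM gate on `m` points (so of width `≤ m^c`, `c ≥ 1`), for
every wiring and target. [folklore] -/
theorem transpositionGate_isPermGate {m k : ℕ} (w : Fin k → EV m) (τ : Equiv.Perm (Fin m)) :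
    IsPermGate m ⟨k, fun v => decide (τ ∈ Subgroup.closure ((fun i => Sym2.lift
      ⟨fun a b => Equiv.swap a b, fun a b => Equiv.swap_comm a b⟩ ((w i : EV m) : Sym2 (Fin m))) ''
        {i | v i = true}))⟩ :=
  ⟨m, le_rfl, fun i => Sym2.lift ⟨fun a b => Equiv.swap a b, fun a b => Equiv.swap_comm a b⟩
    ((w i : EV m) : Sym2 (Fin m)), τ, fun _ => decide_eq_true_iff⟩

/-! ## §2 Almost every negative of the referee pair has diameter two -/

open Classical in
/-- The "no common neighbour" clause of a pair `u ≠ v` and a vertex set `A` — the edges `zu`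
(`z ∈ A`) and `zv` (`z ∉ A`), `z ∉ {u, v}` — has at least `m - 2` edges. [folklore] -/
theorem le_card_nccClause {m : ℕ} {u v : Fin m} (huv : u ≠ v) (A : Finset (Fin m)) :
    m - 2 ≤ #(univ.filter fun e : EV m => ∃ z : Fin m, z ≠ u ∧ z ≠ v ∧
      ((z ∈ A ∧ (e : Sym2 (Fin m)) = s(z, u)) ∨ (z ∉ A ∧ (e : Sym2 (Fin m)) = s(z, v)))) := by
  set W := (univ.filter fun z : Fin m => z ≠ u ∧ z ≠ v) with hW
  have hWcard : m - 2 ≤ #W := by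
    have h1 : #W + #(univ.filter fun z : Fin m => ¬ (z ≠ u ∧ z ≠ v)) = m := by
      rw [hW, card_filter_add_card_filter_not, card_univ, Fintype.card_fin]
    have h2 : #(univ.filter fun z : Fin m => ¬ (z ≠ u ∧ z ≠ v)) ≤ 2 :=
      (card_le_card fun z hz => by
        rw [mem_insert, mem_singleton]
        exact not_and_or.1 (mem_filter.1 hz).2 |>.imp not_not.1 not_not.1).trans (card_le_two)
    omega
  have hmem : ∀ a b : Fin m, a ≠ b → s(a, b) ∈ (⊤ : SimpleGraph (Fin m)).edgeSet := fun a b h => by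
    rwa [SimpleGraph.mem_edgeSet, SimpleGraph.top_adj]
  obtain ⟨F, hFval⟩ : ∃ F : Fin m → EV m, ∀ z ∈ W,
      ((F z : EV m) : Sym2 (Fin m)) = if z ∈ A then s(z, u) else s(z, v) := by
    refine ⟨fun z => if h₁ : z ≠ u ∧ z ∈ A then ⟨s(z, u), hmem z u h₁.1⟩
      else if h₂ : z ≠ v then ⟨s(z, v), hmem z v h₂⟩ else ⟨s(u, v), hmem u v huv⟩, fun z hz => ?_⟩
    rw [hW, mem_filter] at hz
    obtain ⟨-, hzu, hzv⟩ := hz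
    dsimp only
    by_cases hA : z ∈ A
    · have h : (z ≠ u ∧ z ∈ A) := ⟨hzu, hA⟩
      rw [dif_pos h, if_pos hA]
    · have h : ¬ (z ≠ u ∧ z ∈ A) := fun h' => hA h'.2
      rw [dif_neg h, dif_pos hzv, if_neg hA]
  refine hWcard.trans (card_le_card_of_injOn F (fun z hz => ?_) ?_)
  · have hz' : z ∈ W := hz
    have hz2 := hz'
    rw [hW, mem_filter] at hz2
    obtain ⟨-, hzu, hzv⟩ := hz2
    rw [mem_coe, mem_filter]
    refine ⟨mem_univ _, z, hzu, hzv, ?_⟩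
    by_cases hA : z ∈ A
    · left
      exact ⟨hA, by rw [hFval z hz', if_pos hA]⟩
    · right
      exact ⟨hA, by rw [hFval z hz', if_neg hA]⟩
  · intro z hz z' hz' hzz
    have hz2 : z ∈ W := hz
    have hz2' : z' ∈ W := hz'
    have h : ((F z : EV m) : Sym2 (Fin m)) = ((F z' : EV m) : Sym2 (Fin m)) := by rw [hzz]
    rw [hFval z hz2, hFval z' hz2'] at h
    rw [hW, mem_filter] at hz2 hz2'
    split_ifs at h with ha hb hb <;> rw [Sym2.eq_iff] at h <;>
      rcases h with ⟨h, -⟩ | ⟨h, h'⟩ <;> first | exact h | exact absurd h hz2.2.1 |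
        exact absurd h hz2.2.2

open Classical in
/-- A vector NOT of diameter two falsifies some "no common neighbour" clause: take a pair `u ≠ v`
without common neighbour and `A :=` the vertices not adjacent to `u`. [folklore] -/
theorem exists_nccClause_of_not_diamTwo {m : ℕ} (y : EV m → Bool)
    (hy : ¬ ∀ u v : Fin m, u ≠ v → ∃ w : Fin m,
      (∃ e : EV m, (e : Sym2 (Fin m)) = s(w, u) ∧ y e = true) ∧
      (∃ e : EV m, (e : Sym2 (Fin m)) = s(w, v) ∧ y e = true)) :
    ∃ u v : Fin m, u ≠ v ∧ ∃ A : Finset (Fin m),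
      ¬ SatClause (univ.filter fun e : EV m => ∃ z : Fin m, z ≠ u ∧ z ≠ v ∧
        ((z ∈ A ∧ (e : Sym2 (Fin m)) = s(z, u)) ∨ (z ∉ A ∧ (e : Sym2 (Fin m)) = s(z, v)))) y := by
  by_contra hcon
  apply hy
  intro u v huv
  by_contra hw
  apply hcon
  refine ⟨u, v, huv, univ.filter fun z : Fin m =>
    ¬ ∃ e : EV m, (e : Sym2 (Fin m)) = s(z, u) ∧ y e = true, ?_⟩
  rintro ⟨e, he, hye⟩
  rw [mem_filter] at he
  obtain ⟨-, z, hzu, hzv, hz⟩ := he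
  rcases hz with ⟨hzA, hze⟩ | ⟨hzA, hze⟩
  · rw [mem_filter] at hzA
    exact hzA.2 ⟨e, hze, hye⟩
  · rw [mem_filter, not_and] at hzA
    have hzu' : ∃ e : EV m, (e : Sym2 (Fin m)) = s(z, u) ∧ y e = true := by
      by_contra h
      exact hzA (mem_univ _) h
    exact hw ⟨z, hzu', e, hze, hye⟩

open Classical in
/-- **Union bound.** Among the negatives of the referee pair (complements of the
`(#E/⌊m^{1/8}⌋₊)`-subsets `M` of the edge slots), those NOT of diameter two number at most
`m · m · 2^m / ⌊m^{1/8}⌋₊^{m-2}` of all (cross-multiplied): such a negative has all `≥ m - 2` edges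
of one of the `≤ m² 2^m` "no common neighbour" clauses inside `M`, and a fixed clause `S` lies
inside `M` for at most a `⌊m^{1/8}⌋₊^{-#S}` fraction of the `M` (`card_filter_neg_mul_pow_le`).
[folklore] -/
theorem card_negFilter_not_diamTwo_mul_le (m : ℕ) :
    #((((powersetCard (Fintype.card (EV m) / ⌊(m : ℝ) ^ (1 / 8 : ℝ)⌋₊)
        (univ : Finset (EV m))).image (fun M => fun e => decide (e ∉ M))).filter fun y =>
          ¬ ∀ u v : Fin m, u ≠ v → ∃ w : Fin m,
            (∃ e : EV m, (e : Sym2 (Fin m)) = s(w, u) ∧ y e = true) ∧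
            (∃ e : EV m, (e : Sym2 (Fin m)) = s(w, v) ∧ y e = true))) *
        ⌊(m : ℝ) ^ (1 / 8 : ℝ)⌋₊ ^ (m - 2) ≤
      (m * m * 2 ^ m) * #(((powersetCard (Fintype.card (EV m) / ⌊(m : ℝ) ^ (1 / 8 : ℝ)⌋₊)
        (univ : Finset (EV m))).image (fun M => fun e => decide (e ∉ M)))) := by
  set D : ℕ := ⌊(m : ℝ) ^ (1 / 8 : ℝ)⌋₊ with hDdef
  set N := ((powersetCard (Fintype.card (EV m) / D) (univ : Finset (EV m))).image
    (fun M => fun e => decide (e ∉ M))) with hNdef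
  rcases Nat.lt_or_ge m 2 with hm | hm
  · -- fewer than two vertices: every vector has diameter two vacuously
    have h0 : (N.filter fun y => ¬ ∀ u v : Fin m, u ≠ v → ∃ w : Fin m,
        (∃ e : EV m, (e : Sym2 (Fin m)) = s(w, u) ∧ y e = true) ∧
        (∃ e : EV m, (e : Sym2 (Fin m)) = s(w, v) ∧ y e = true)) = ∅ := by
      refine filter_eq_empty_iff.2 fun y _ h => h fun u v huv => ?_
      exact absurd (Fin.ext (by omega)) huv
    rw [h0, card_empty, zero_mul]
    exact Nat.zero_le _
  · have hD : 1 ≤ D := by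
      rw [hDdef, Nat.one_le_floor_iff]
      exact Real.one_le_rpow (by exact_mod_cast (show 1 ≤ m by omega)) (by norm_num)
    have htD : Fintype.card (EV m) / D * D ≤ Fintype.card (EV m) := Nat.div_mul_le_self _ _
    -- the pieces of the union bound
    set F := ((univ : Finset (Fin m × Fin m × Finset (Fin m))).filter fun p => p.1 ≠ p.2.1)
      with hFdef
    have hcover := card_mul_le_of_subset_biUnion
      (N.filter fun y => ¬ ∀ u v : Fin m, u ≠ v → ∃ w : Fin m,
        (∃ e : EV m, (e : Sym2 (Fin m)) = s(w, u) ∧ y e = true) ∧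
        (∃ e : EV m, (e : Sym2 (Fin m)) = s(w, v) ∧ y e = true))
      F (fun p => N.filter fun y => ¬ SatClause (univ.filter fun e : EV m => ∃ z : Fin m,
        z ≠ p.1 ∧ z ≠ p.2.1 ∧ ((z ∈ p.2.2 ∧ (e : Sym2 (Fin m)) = s(z, p.1)) ∨
          (z ∉ p.2.2 ∧ (e : Sym2 (Fin m)) = s(z, p.2.1)))) y)
      (W := D ^ (m - 2)) (total := #N) ?_ ?_
    · refine hcover.trans (Nat.mul_le_mul_right _ ?_)
      calc #F ≤ #(univ : Finset (Fin m × Fin m × Finset (Fin m))) := card_filter_le _ _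
        _ = m * m * 2 ^ m := by
          rw [card_univ, Fintype.card_prod, Fintype.card_prod, Fintype.card_finset,
            Fintype.card_fin, mul_assoc]
    · intro y hy
      rw [mem_filter] at hy
      obtain ⟨hyN, hbad⟩ := hy
      obtain ⟨u, v, huv, A, hA⟩ := exists_nccClause_of_not_diamTwo y hbad
      rw [mem_biUnion]
      exact ⟨(u, v, A), by rw [hFdef, mem_filter]; exact ⟨mem_univ _, huv⟩,
        mem_filter.2 ⟨hyN, hA⟩⟩
    · rintro ⟨u, v, A⟩ hp
      rw [hFdef, mem_filter] at hp
      have huv : u ≠ v := hp.2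
      set S := (univ.filter fun e : EV m => ∃ z : Fin m, z ≠ u ∧ z ≠ v ∧
        ((z ∈ A ∧ (e : Sym2 (Fin m)) = s(z, u)) ∨ (z ∉ A ∧ (e : Sym2 (Fin m)) = s(z, v))))
        with hSdef
      have hS : m - 2 ≤ #S := le_card_nccClause huv A
      have hmass := card_filter_neg_mul_pow_le hD htD (fun M => fun e => decide (e ∉ M))
        (fun M e => by simp) S (fun y => ¬ SatClause S y) (fun _ h => h)
      calc #(N.filter fun y => ¬ SatClause S y) * D ^ (m - 2)
          ≤ #(N.filter fun y => ¬ SatClause S y) * D ^ #S :=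
            Nat.mul_le_mul_left _ (Nat.pow_le_pow_right hD hS)
        _ ≤ #N := hmass

/-- **Numerics.** Eventually `8 m^{c+1} · m · m · 2^m ≤ ⌊m^{1/8}⌋₊^{m-2}` (`⌊m^{1/8}⌋₊ ≥ 4` once
`m ≥ 4^8`, and `128 m^{c+3} ≤ 2^m` for large `m`). [folklore] -/
theorem eventually_diam_numerics (c : ℕ) :
    ∀ᶠ m : ℕ in atTop, 8 * m ^ (c + 1) * (m * m * 2 ^ m) ≤ ⌊(m : ℝ) ^ (1 / 8 : ℝ)⌋₊ ^ (m - 2) := by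
  obtain ⟨n₀, hn₀⟩ := exists_mul_pow_le_two_pow (c + 3) 128
  filter_upwards [eventually_ge_atTop (max n₀ (4 ^ 8))] with m hm
  have hm₀ : n₀ ≤ m := le_of_max_le_left hm
  have hm4 : 4 ^ 8 ≤ m := le_of_max_le_right hm
  have hD : 4 ≤ ⌊(m : ℝ) ^ (1 / 8 : ℝ)⌋₊ := by
    by_contra hlt
    rw [not_le] at hlt
    have h1 := lt_floor_rpow_add_one_pow m 8 (e := 1 / 8) (by norm_num)
    have h2 : (⌊(m : ℝ) ^ (1 / 8 : ℝ)⌋₊ + 1) ^ 8 ≤ 4 ^ 8 :=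
      Nat.pow_le_pow_left (by omega) 8
    omega
  have h2 : 128 * m ^ (c + 3) ≤ 2 ^ m := hn₀ m hm₀
  have hm2 : 2 ≤ m := le_trans (by norm_num) hm4
  calc 8 * m ^ (c + 1) * (m * m * 2 ^ m) = 8 * m ^ (c + 3) * 2 ^ m := by ring
    _ ≤ 4 ^ (m - 2) := by
        have h4 : (4 : ℕ) ^ m = 16 * 4 ^ (m - 2) := by
          conv_lhs => rw [show m = (m - 2) + 2 by omega, pow_add]
          ring
        have h5 : 2 ^ m * 2 ^ m = (4 : ℕ) ^ m := by
          rw [← mul_pow]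
          norm_num
        have h6 : 16 * (8 * m ^ (c + 3) * 2 ^ m) ≤ 16 * 4 ^ (m - 2) :=
          calc 16 * (8 * m ^ (c + 3) * 2 ^ m) = 128 * m ^ (c + 3) * 2 ^ m := by ring
            _ ≤ 2 ^ m * 2 ^ m := Nat.mul_le_mul_right _ h2
            _ = 16 * 4 ^ (m - 2) := by rw [h5, h4]
        exact Nat.le_of_mul_le_mul_left h6 (by norm_num)
    _ ≤ ⌊(m : ℝ) ^ (1 / 8 : ℝ)⌋₊ ^ (m - 2) := Nat.pow_le_pow_left hD _

/-! ## §3 The sub-class result: gates accepting every diameter-two graph are sandwichable -/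

open Classical in
/-- PROPOSED SUB-GOAL (binder-free; a structural sub-class of the leaf `stub_permCnf` that is
always NEG-BLIND at the sharp threshold). **Every Boolean function of the edge slots that accepts
every graph of diameter two has, on the referee pair, a legal local pair with both errors
`≤ 1/(8 m^{c+1})`** — for every `c`, all large `m`, every family `P` of positives and every
locality `(r, s)`: it rejects at most `m² 2^m / ⌊m^{1/8}⌋₊^{m-2} · #N ≤ #N / (8 m^{c+1})` negatives
(`card_negFilter_not_diamTwo_mul_le`, `eventually_diam_numerics`), so the constant pair `({∅}, ∅)`
does it (`Horns.pair_of_blind`). Members of the sub-class among the PERM gates reading local CNFs: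
the vertex-transposition gates with ANY target (`transpositionGate_accepts_of_diamTwo`; nonabelian,
wide), the graphic `𝔽₂` span programs / `T`-join gates (`w_{uv} = e_u + e_v`), `u–v` connectivity
gates, and every gate accepting all connected graphs. [folklore] -/
theorem pair_of_acceptsDiamTwo : ∀ c : ℕ, ∀ᶠ m : ℕ in atTop, ∀ g : (EV m → Bool) → Bool,
    (∀ y : EV m → Bool, (∀ u v : Fin m, u ≠ v → ∃ w : Fin m,
        (∃ e : EV m, (e : Sym2 (Fin m)) = s(w, u) ∧ y e = true) ∧
        (∃ e : EV m, (e : Sym2 (Fin m)) = s(w, v) ∧ y e = true)) → g y = true) →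
    ∀ (P : Finset (EV m → Bool)) (r s : ℕ),
    ∃ dnf cnf : Finset (Finset (EV m)), (∀ R ∈ dnf, #R ≤ r - 1) ∧ (∀ S ∈ cnf, #S ≤ s - 1) ∧
      (∀ x, EvalDNF dnf x → EvalCNF cnf x) ∧
      (#(P.filter fun x => g x = true ∧ ¬ EvalDNF dnf x) : ℝ) ≤
        (1 / (8 * (m : ℝ) ^ (c + 1))) * #P ∧
      (#((((powersetCard (Fintype.card (EV m) / ⌊(m : ℝ) ^ (1 / 8 : ℝ)⌋₊)
        (univ : Finset (EV m))).image (fun M => fun e => decide (e ∉ M)))).filter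
          fun x => EvalCNF cnf x ∧ g x = false) : ℝ) ≤
        (1 / (8 * (m : ℝ) ^ (c + 1))) *
          #(((powersetCard (Fintype.card (EV m) / ⌊(m : ℝ) ^ (1 / 8 : ℝ)⌋₊)
            (univ : Finset (EV m))).image (fun M => fun e => decide (e ∉ M)))) := by
  intro c
  filter_upwards [eventually_diam_numerics c, eventually_ge_atTop 1] with m hnum hm g hg P r s
  refine Horns.pair_of_blind g P _ (by positivity) r s (Or.inr ?_)
  set D : ℕ := ⌊(m : ℝ) ^ (1 / 8 : ℝ)⌋₊ with hDdef
  set N := ((powersetCard (Fintype.card (EV m) / D) (univ : Finset (EV m))).image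
    (fun M => fun e => decide (e ∉ M))) with hNdef
  have hD : 1 ≤ D := by
    rw [hDdef, Nat.one_le_floor_iff]
    exact Real.one_le_rpow (by exact_mod_cast hm) (by norm_num)
  have hsub : N.filter (fun x => g x = false) ⊆ N.filter fun y =>
      ¬ ∀ u v : Fin m, u ≠ v → ∃ w : Fin m,
        (∃ e : EV m, (e : Sym2 (Fin m)) = s(w, u) ∧ y e = true) ∧
        (∃ e : EV m, (e : Sym2 (Fin m)) = s(w, v) ∧ y e = true) := by
    intro y hy
    rw [mem_filter] at hy ⊢
    refine ⟨hy.1, fun hdiam => ?_⟩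
    have := hg y hdiam
    rw [hy.2] at this
    exact Bool.false_ne_true this
  have hbad := card_negFilter_not_diamTwo_mul_le m
  have key : #(N.filter fun x => g x = false) * (8 * m ^ (c + 1)) ≤ #N := by
    have hDpos : 0 < D ^ (m - 2) := pow_pos hD _
    refine Nat.le_of_mul_le_mul_right ?_ hDpos
    calc #(N.filter fun x => g x = false) * (8 * m ^ (c + 1)) * D ^ (m - 2)
        = #(N.filter fun x => g x = false) * D ^ (m - 2) * (8 * m ^ (c + 1)) := by ring
      _ ≤ #(N.filter fun y => ¬ ∀ u v : Fin m, u ≠ v → ∃ w : Fin m,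
            (∃ e : EV m, (e : Sym2 (Fin m)) = s(w, u) ∧ y e = true) ∧
            (∃ e : EV m, (e : Sym2 (Fin m)) = s(w, v) ∧ y e = true)) * D ^ (m - 2) *
            (8 * m ^ (c + 1)) :=
          Nat.mul_le_mul_right _ (Nat.mul_le_mul_right _ (card_le_card hsub))
      _ ≤ (m * m * 2 ^ m) * #N * (8 * m ^ (c + 1)) := Nat.mul_le_mul_right _ hbad
      _ = 8 * m ^ (c + 1) * (m * m * 2 ^ m) * #N := by ring
      _ ≤ D ^ (m - 2) * #N := Nat.mul_le_mul_right _ hnum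
      _ = #N * D ^ (m - 2) := by ring
  exact cast_le_eps_mul hm key

open Classical in
/-- **The vertex-transposition gates satisfy the leaf `stub_permCnf`** (any target `τ`, any wiring
`w` onto the edge slots, raw single-edge children `C j = {{w j}}`; the gate is a PERM gate on `m`
points, `transpositionGate_isPermGate`, and for `τ = (a b)` it is WIDE — the `a–b` path through all
vertices is a minterm of `m - 1 > ⌊m^{1/16}⌋₊ (log₂ ⌊m^{1/16}⌋₊ + 1)` wires — and NOT blind on the
positives at the sharp threshold when `c ≥ 1`: it accepts the `≈ m^{-3/2} > 1/(8m²)` fraction of the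
bare cliques through `a, b`). For every `c` and all large `m` the pair demanded by the leaf exists,
with `g x = τ ∈ ⟨(a b) : x_{ab} = 1⟩` written as the gate composed with the values of its children.
[folklore] -/
theorem transpositionGate_permCnf : ∀ c : ℕ, ∀ᶠ m : ℕ in atTop, ∀ (k : ℕ) (w : Fin k → EV m),
    Function.Surjective w → ∀ (τ : Equiv.Perm (Fin m)) (r s : ℕ),
    ∃ dnf cnf : Finset (Finset (EV m)), (∀ R ∈ dnf, #R ≤ r - 1) ∧ (∀ S ∈ cnf, #S ≤ s - 1) ∧
      (∀ x, EvalDNF dnf x → EvalCNF cnf x) ∧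
      (#((posGraphs m ⌈(m : ℝ) ^ (1 / 4 : ℝ)⌉₊).filter fun x =>
          decide (τ ∈ Subgroup.closure ((fun i => Sym2.lift ⟨fun a b => Equiv.swap a b,
            fun a b => Equiv.swap_comm a b⟩ ((w i : EV m) : Sym2 (Fin m))) ''
              {i | (fun j => decide (EvalCNF ({{w j}} : Finset (Finset (EV m))) x)) i = true}))
            = true ∧ ¬ EvalDNF dnf x) : ℝ) ≤
        (1 / (8 * (m : ℝ) ^ (c + 1))) * #(posGraphs m ⌈(m : ℝ) ^ (1 / 4 : ℝ)⌉₊) ∧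
      (#((((powersetCard (Fintype.card (EV m) / ⌊(m : ℝ) ^ (1 / 8 : ℝ)⌋₊)
        (univ : Finset (EV m))).image (fun M => fun e => decide (e ∉ M)))).filter
          fun x => EvalCNF cnf x ∧
            decide (τ ∈ Subgroup.closure ((fun i => Sym2.lift ⟨fun a b => Equiv.swap a b,
              fun a b => Equiv.swap_comm a b⟩ ((w i : EV m) : Sym2 (Fin m))) ''
                {i | (fun j => decide (EvalCNF ({{w j}} : Finset (Finset (EV m))) x)) i = true}))
              = false) : ℝ) ≤
        (1 / (8 * (m : ℝ) ^ (c + 1))) *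
          #(((powersetCard (Fintype.card (EV m) / ⌊(m : ℝ) ^ (1 / 8 : ℝ)⌋₊)
            (univ : Finset (EV m))).image (fun M => fun e => decide (e ∉ M)))) := by
  intro c
  filter_upwards [pair_of_acceptsDiamTwo c] with m hm k w hw τ r s
  refine hm _ (fun y hy => ?_) _ r s
  rw [decide_eq_true_iff]
  have hset : {i : Fin k | (fun j => decide (EvalCNF ({{w j}} : Finset (Finset (EV m))) y)) i =
      true} = {i | y (w i) = true} := by
    ext i
    simp only [Set.mem_setOf_eq, decide_eq_true_eq, evalCNF_singleton_singleton]
  rw [hset]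
  exact transpositionGate_accepts_of_diamTwo w hw τ y hy

end Summit.PneNP.PneNP.Theorems.CliqueExtLowerBound.WidthThreshold.DiamTwo

end
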